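import Summits.Ventures.HSemireg.WedgeHankelSubstitutionShearCentralizerCharP
import Summits.Ventures.HSemireg.WedgeHankelSubstitutionJordanPartitionParabolic

/-!
# Venture HSemireg — THE CENTRALIZER OF EVERY PARABOLIC SUBSTITUTION: conjugate endomorphisms have isomorphic centralizers (`A·Q = Q·B`, `Q` invertible: `x ↦ Q′xQ`),
# `Centralizer(A − c·1) = Centralizer(A) = Centralizer(c·A)`, so for a parabolic `g` (double `K`-rational node, `a = α+λ₁γ ≠ 0`, `γ ≠ 0`) in characteristic `p`:
# `dim Centralizer(SbC g) = ⌊n/p⌋(n+1) + (⌊n/p⌋+1)(n mod p + 1)` (K22's count for the shear, transported by J11's conjugation), and `= n + 1` when `n!` is a unit (K13)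

HONEST FRAMING. Part of the Lean index of the computation cell `pub-hsemireg` (seat p10 gen 22, Sunday typer «UNIFORM-IN-n»).
Finite-dimensional EXTERIOR ALGEBRA + linear algebra ONLY: no variety, no cohomology theory, no sheaf, no Ext group, no semiregularity map;
nothing here says that HC / HC_CM / HC_AV holds; no Literature fact is declared or used.  Custodian versions as in `WedgeHankelSiegelIdeal` (1/3) and `WedgeHankelFrameChange`;
the dictionary (a parabolic element of `GL₂` is conjugate to a scalar times a shear; commutants are conjugation invariants) is QUOTED, never asserted.

WHAT IS IN THE TREE.  K22 (`WedgeHankelSubstitutionShearCentralizerCharP`): `mem_centralizer_shear_iff`, **`finrank_centralizer_shear_char`** (the shear, characteristic `p`); K13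
(`…ShearCentralizer`): `commute_shear_iff_mem_span_pow`, `finrank_span_pow_shear_sub_one` (`n!·λ ≠ 0`: the centralizer is `K[N]`, dimension `n + 1`); J11 (`…ParabolicCharP`):
**`SbC_sub_mul_conj_of_parabolic`** (`(SbC g − a^n)·Q = Q·(a^n • (SbC(1 (γ/a) 0 1) − 1))`, `Q = SbC(1 λ₁ 0 1)·SbC(0 1 1 0)`), `conj_mul_inv` / `inv_mul_conj`, `SbC_upper_parabolic`,
`SbC_lower_shear_eq_swap_conj`, `SbC_swap_mul_swap`; K5: the kernel dimensions transported the same way.  THIS FILE (namespace `Summit.Ventures.HSemireg.Wedge.HankelFrameChange` continued;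
imports K22, K5):
* §346 GENERALITY (membership `x ∈ Centralizer{A} ⇔ A·x = x·A` is Mathlib's `Subalgebra.mem_centralizer_iff`, used inline): **`finrank_centralizer_eq_of_conj`** (`A·Q = Q·B`, `QQ′ = Q′Q = 1` ⇒ equal dimensions, via the
  linear bijection `x ↦ Q′xQ`), **`centralizer_sub_smul_one`** (`Centralizer{A − c·1} = Centralizer{A}`), **`centralizer_smul_of_ne_zero`** (`Centralizer{c·A} = Centralizer{A}`, `c ≠ 0`).
* §347 TH-7's CLASSES: **`finrank_centralizer_shear_of_factorial`** (`n!·λ ≠ 0`: `dim Centralizer(SbC(1 λ 0 1)) = n + 1`, K13 repackaged on the subalgebra), `…_charZero`,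
  **`finrank_centralizer_SbC_parabolic_char`** (parabolic `g`, `γ ≠ 0`, characteristic `p`: `= ⌊n/p⌋(n+1) + (⌊n/p⌋+1)(n mod p + 1)`), **`finrank_centralizer_SbC_parabolic_of_factorial`**
  (`= n + 1` when `n! ≠ 0`), **`finrank_centralizer_SbC_upper_parabolic_char`** / `_of_factorial` (`SbC(α β 0 α)`, `β ≠ 0`), **`finrank_centralizer_SbC_lower_shear_char`** /
  `_of_factorial` (the lower shear, swap-conjugate).
NOT typed here: parabolic `g` with an inseparable double node (characteristic `2`); the algebra structure of the centralizer; anything Ext-side.  New names only.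
-/

open Module

namespace Summit.Ventures.HSemireg.Wedge.HankelFrameChange

open Summit.Ventures.HSemireg.Wedge Summit.Ventures.HSemireg.Wedge.Kunneth Summit.Ventures.HSemireg.Wedge.Hankel
  Summit.Ventures.HSemireg.Wedge.BasisFree Summit.Ventures.HSemireg.Wedge.HankelSiegel Summit.Ventures.HSemireg.Wedge.HankelSiegelIdeal
  Summit.Ventures.HSemireg.Wedge.KunnethKernel Summit.Ventures.HSemireg.Wedge.HankelRankOne Summit.Ventures.HSemireg.Wedge.KernelDuality

variable (K : Type*) [Field K] {n : ℕ}

/-! ## §346. Generality: conjugate endomorphisms have isomorphic centralizers -/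

section Conj

variable {V : Type*} [AddCommGroup V] [Module K V]

/-- conjugation by `Q` carries the centralizer of `A` into the centralizer of `B = Q′AQ` (`A·Q = Q·B`, `Q·Q′ = 1`, `Q′·Q = 1`). -/
theorem conj_mem_centralizer_of_conj {A B Q Q' : Module.End K V} (h : A * Q = Q * B) (hQ : Q * Q' = 1) (hQ' : Q' * Q = 1) {x : Module.End K V}
    (hx : x ∈ Subalgebra.centralizer K ({A} : Set (Module.End K V))) : Q' * x * Q ∈ Subalgebra.centralizer K ({B} : Set (Module.End K V)) := by
  simp only [Subalgebra.mem_centralizer_iff, Set.mem_singleton_iff, forall_eq] at hx ⊢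
  have hB : B = Q' * A * Q := by rw [mul_assoc, h, ← mul_assoc, hQ', one_mul]
  rw [hB]
  calc Q' * A * Q * (Q' * x * Q) = Q' * A * (Q * Q') * x * Q := by simp only [mul_assoc]
    _ = Q' * (x * A) * Q := by rw [hQ, mul_one, mul_assoc Q' A x, hx]
    _ = Q' * x * (Q * Q') * A * Q := by rw [hQ, mul_one, ← mul_assoc]
    _ = Q' * x * Q * (Q' * A * Q) := by simp only [mul_assoc]

/-- **CONJUGATE ENDOMORPHISMS HAVE CENTRALIZERS OF THE SAME DIMENSION**: `A·Q = Q·B` with `Q` invertible ⇒ `dim Centralizer{A} = dim Centralizer{B}` (the linear bijection `x ↦ Q′xQ`). -/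
theorem finrank_centralizer_eq_of_conj {A B Q Q' : Module.End K V} (h : A * Q = Q * B) (hQ : Q * Q' = 1) (hQ' : Q' * Q = 1) :
    finrank K ↥(Subalgebra.centralizer K ({A} : Set (Module.End K V))) = finrank K ↥(Subalgebra.centralizer K ({B} : Set (Module.End K V))) := by
  have h' : B * Q' = Q' * A := by
    have hB : B = Q' * A * Q := by rw [mul_assoc, h, ← mul_assoc, hQ', one_mul]
    rw [hB, mul_assoc, hQ, mul_one]
  let F : ↥(Subalgebra.centralizer K ({A} : Set (Module.End K V))) →ₗ[K] ↥(Subalgebra.centralizer K ({B} : Set (Module.End K V))) :=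
    { toFun := fun x => ⟨Q' * x * Q, conj_mem_centralizer_of_conj K h hQ hQ' x.2⟩
      map_add' := fun x y => Subtype.ext (by simp only [Subalgebra.coe_add, mul_add, add_mul])
      map_smul' := fun c x => Subtype.ext (by simp only [Subalgebra.coe_smul, RingHom.id_apply, mul_smul_comm, smul_mul_assoc]) }
  let G : ↥(Subalgebra.centralizer K ({B} : Set (Module.End K V))) →ₗ[K] ↥(Subalgebra.centralizer K ({A} : Set (Module.End K V))) :=
    { toFun := fun y => ⟨Q * y * Q', conj_mem_centralizer_of_conj K h' hQ' hQ y.2⟩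
      map_add' := fun x y => Subtype.ext (by simp only [Subalgebra.coe_add, mul_add, add_mul])
      map_smul' := fun c x => Subtype.ext (by simp only [Subalgebra.coe_smul, RingHom.id_apply, mul_smul_comm, smul_mul_assoc]) }
  have hGF : ∀ x, G (F x) = x := fun x => Subtype.ext (by
    show Q * (Q' * (x : Module.End K V) * Q) * Q' = x
    calc Q * (Q' * (x : Module.End K V) * Q) * Q' = (Q * Q') * x * (Q * Q') := by simp only [mul_assoc]
      _ = x := by rw [hQ, one_mul, mul_one])
  have hFG : ∀ y, F (G y) = y := fun y => Subtype.ext (by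
    show Q' * (Q * (y : Module.End K V) * Q') * Q = y
    calc Q' * (Q * (y : Module.End K V) * Q') * Q = (Q' * Q) * y * (Q' * Q) := by simp only [mul_assoc]
      _ = y := by rw [hQ', one_mul, mul_one])
  exact (LinearEquiv.ofLinear F G (LinearMap.ext hFG) (LinearMap.ext hGF)).finrank_eq

/-- **`Centralizer{A − c·1} = Centralizer{A}`** (commuting with `A − c·1` is commuting with `A`). -/
theorem centralizer_sub_smul_one (A : Module.End K V) (c : K) :
    Subalgebra.centralizer K ({A - c • 1} : Set (Module.End K V)) = Subalgebra.centralizer K ({A} : Set (Module.End K V)) := by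
  ext x
  simp only [Subalgebra.mem_centralizer_iff, Set.mem_singleton_iff, forall_eq]
  rw [sub_mul, mul_sub, smul_mul_assoc, mul_smul_comm, one_mul, mul_one, sub_left_inj]

/-- **`Centralizer{c·A} = Centralizer{A}`** for `c ≠ 0`. -/
theorem centralizer_smul_of_ne_zero (A : Module.End K V) {c : K} (hc : c ≠ 0) :
    Subalgebra.centralizer K ({c • A} : Set (Module.End K V)) = Subalgebra.centralizer K ({A} : Set (Module.End K V)) := by
  ext x
  simp only [Subalgebra.mem_centralizer_iff, Set.mem_singleton_iff, forall_eq]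
  rw [smul_mul_assoc, mul_smul_comm]
  exact ⟨fun h => smul_right_injective _ hc h, fun h => by rw [h]⟩

end Conj

/-! ## §347. The centralizer of every parabolic substitution on th-7's classes -/

/-- **`n!·λ ≠ 0`: `dim Centralizer(SbC(1 λ 0 1)) = n + 1`** (K13: the centralizer is `K[N]`, here as the dimension of the subalgebra). -/
theorem finrank_centralizer_shear_of_factorial (hfac : ((n.factorial : ℕ) : K) ≠ 0) {lam : K} (hlam : lam ≠ 0) :
    finrank K ↥(Subalgebra.centralizer K ({SbC K 1 lam 0 1} : Set (Module.End K (spikeSpan K n)))) = n + 1 := by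
  rw [← Subalgebra.finrank_toSubmodule]
  have h : Subalgebra.toSubmodule (Subalgebra.centralizer K ({SbC K 1 lam 0 1} : Set (Module.End K (spikeSpan K n)))) =
      Submodule.span K (Set.range fun k : Fin (n + 1) => (SbC K 1 lam 0 1 (n := n) - 1) ^ (k : ℕ)) := by
    ext φ
    rw [Subalgebra.mem_toSubmodule]
    simp only [Subalgebra.mem_centralizer_iff, Set.mem_singleton_iff, forall_eq]
    rw [eq_comm, commute_shear_iff_mem_span_pow K hfac hlam]
  rw [h, finrank_span_pow_shear_sub_one K hfac hlam]

/-- characteristic `0`: `dim Centralizer(SbC(1 λ 0 1)) = n + 1` for every `λ ≠ 0`. -/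
theorem finrank_centralizer_shear_charZero [CharZero K] {lam : K} (hlam : lam ≠ 0) :
    finrank K ↥(Subalgebra.centralizer K ({SbC K 1 lam 0 1} : Set (Module.End K (spikeSpan K n)))) = n + 1 :=
  finrank_centralizer_shear_of_factorial K (Nat.cast_ne_zero.mpr (Nat.factorial_ne_zero n)) hlam

/-- the centralizer of a parabolic substitution is conjugate to that of the shear `SbC(1 (γ/a) 0 1)` (J11's conjugation): equal dimensions, every field. -/
theorem finrank_centralizer_SbC_parabolic_eq {α β γ δ l₁ : K} (e₁ : β + l₁ * δ = l₁ * (α + l₁ * γ)) (hpar : δ - l₁ * γ = α + l₁ * γ) (ha : α + l₁ * γ ≠ 0) :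
    finrank K ↥(Subalgebra.centralizer K ({SbC K α β γ δ} : Set (Module.End K (spikeSpan K n)))) =
      finrank K ↥(Subalgebra.centralizer K ({SbC K 1 (γ / (α + l₁ * γ)) 0 1} : Set (Module.End K (spikeSpan K n)))) := by
  rw [← centralizer_sub_smul_one K (SbC K α β γ δ) ((α + l₁ * γ) ^ n), finrank_centralizer_eq_of_conj K (SbC_sub_mul_conj_of_parabolic K e₁ hpar ha) (conj_mul_inv K l₁)
    (inv_mul_conj K l₁), centralizer_smul_of_ne_zero K _ (pow_ne_zero n ha)]
  have h1 : SbC K 1 (γ / (α + l₁ * γ)) 0 1 (n := n) - 1 = SbC K 1 (γ / (α + l₁ * γ)) 0 1 - (1 : K) • 1 := by rw [one_smul]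
  rw [h1, centralizer_sub_smul_one]

/-- **A PARABOLIC SUBSTITUTION IN CHARACTERISTIC `p` (double `K`-rational node `λ₁`, `a = α+λ₁γ ≠ 0`, `γ ≠ 0`): `dim Centralizer(SbC g) = ⌊n/p⌋(n+1) + (⌊n/p⌋+1)(n mod p + 1)`** (K22
transported by the conjugation). -/
theorem finrank_centralizer_SbC_parabolic_char {α β γ δ l₁ : K} (e₁ : β + l₁ * δ = l₁ * (α + l₁ * γ)) (hpar : δ - l₁ * γ = α + l₁ * γ) (ha : α + l₁ * γ ≠ 0) (hγ : γ ≠ 0)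
    (p : ℕ) [Fact p.Prime] [CharP K p] :
    finrank K ↥(Subalgebra.centralizer K ({SbC K α β γ δ} : Set (Module.End K (spikeSpan K n)))) = n / p * (n + 1) + (n / p + 1) * (n % p + 1) := by
  rw [finrank_centralizer_SbC_parabolic_eq K e₁ hpar ha, finrank_centralizer_shear_char K (div_ne_zero hγ ha) p]

/-- **… and `= n + 1` when `n! ≠ 0` in `K`.** -/
theorem finrank_centralizer_SbC_parabolic_of_factorial (hfac : ((n.factorial : ℕ) : K) ≠ 0) {α β γ δ l₁ : K} (e₁ : β + l₁ * δ = l₁ * (α + l₁ * γ)) (hpar : δ - l₁ * γ = α + l₁ * γ)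
    (ha : α + l₁ * γ ≠ 0) (hγ : γ ≠ 0) : finrank K ↥(Subalgebra.centralizer K ({SbC K α β γ δ} : Set (Module.End K (spikeSpan K n)))) = n + 1 := by
  rw [finrank_centralizer_SbC_parabolic_eq K e₁ hpar ha, finrank_centralizer_shear_of_factorial K hfac (div_ne_zero hγ ha)]

/-- **THE UPPER PARABOLIC `SbC(α β 0 α)` (`α, β ≠ 0`) in characteristic `p`: the same count** (`SbC(α β 0 α) = α^n • SbC(1 (β/α) 0 1)`). -/
theorem finrank_centralizer_SbC_upper_parabolic_char {α β : K} (hα : α ≠ 0) (hβ : β ≠ 0) (p : ℕ) [Fact p.Prime] [CharP K p] :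
    finrank K ↥(Subalgebra.centralizer K ({SbC K α β 0 α} : Set (Module.End K (spikeSpan K n)))) = n / p * (n + 1) + (n / p + 1) * (n % p + 1) := by
  rw [SbC_upper_parabolic K hα, centralizer_smul_of_ne_zero K _ (pow_ne_zero n hα), finrank_centralizer_shear_char K (div_ne_zero hβ hα) p]

/-- the upper parabolic with `n! ≠ 0`: `n + 1`. -/
theorem finrank_centralizer_SbC_upper_parabolic_of_factorial (hfac : ((n.factorial : ℕ) : K) ≠ 0) {α β : K} (hα : α ≠ 0) (hβ : β ≠ 0) :
    finrank K ↥(Subalgebra.centralizer K ({SbC K α β 0 α} : Set (Module.End K (spikeSpan K n)))) = n + 1 := by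
  rw [SbC_upper_parabolic K hα, centralizer_smul_of_ne_zero K _ (pow_ne_zero n hα), finrank_centralizer_shear_of_factorial K hfac (div_ne_zero hβ hα)]

/-- **THE LOWER SHEAR `SbC(1 0 c 1)` (`c ≠ 0`) in characteristic `p`: the same count** (swap-conjugate to the upper shear). -/
theorem finrank_centralizer_SbC_lower_shear_char {c : K} (hc : c ≠ 0) (p : ℕ) [Fact p.Prime] [CharP K p] :
    finrank K ↥(Subalgebra.centralizer K ({SbC K 1 0 c 1} : Set (Module.End K (spikeSpan K n)))) = n / p * (n + 1) + (n / p + 1) * (n % p + 1) := by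
  have h : SbC K 1 0 c 1 (n := n) * SbC K 0 1 1 0 = SbC K 0 1 1 0 * SbC K 1 c 0 1 := by
    rw [SbC_lower_shear_eq_swap_conj, mul_assoc, SbC_swap_mul_swap, mul_one]
  rw [finrank_centralizer_eq_of_conj K h (SbC_swap_mul_swap K) (SbC_swap_mul_swap K), finrank_centralizer_shear_char K hc p]

/-- the lower shear with `n! ≠ 0`: `n + 1`. -/
theorem finrank_centralizer_SbC_lower_shear_of_factorial (hfac : ((n.factorial : ℕ) : K) ≠ 0) {c : K} (hc : c ≠ 0) :
    finrank K ↥(Subalgebra.centralizer K ({SbC K 1 0 c 1} : Set (Module.End K (spikeSpan K n)))) = n + 1 := by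
  have h : SbC K 1 0 c 1 (n := n) * SbC K 0 1 1 0 = SbC K 0 1 1 0 * SbC K 1 c 0 1 := by
    rw [SbC_lower_shear_eq_swap_conj, mul_assoc, SbC_swap_mul_swap, mul_one]
  rw [finrank_centralizer_eq_of_conj K h (SbC_swap_mul_swap K) (SbC_swap_mul_swap K), finrank_centralizer_shear_of_factorial K hfac hc]

end Summit.Ventures.HSemireg.Wedge.HankelFrameChange
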